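import Mathlib
import Summits.Ventures.PercRepro2.PMK5Typed
import Summits.Ventures.PercRepro2.PMK5Strict
import Summits.Ventures.PercRepro2.PMK5Locus
import Summits.Ventures.PercRepro2.PMK5LocusFace

/-!
# THE EQUALITY LOCUS OF THE WEIGHTED (PM) ON FIVE-VERTEX BASES — THE ZERO SIDE, AND THE TWO «IFF»s
(blind cell PercRepro2, mine-2 g23; on `PMK5Locus.lean` (the positive side) and `PMK5LocusFace.lean` (every
coefficient supported inside a degenerate face vanishes); row 2′BETA1)

* `beta1_K5_zero_of_face`: on every DEGENERATE edge set `m` of `K₅` (`RuleB m = true`) the cleared typed bracket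
  `β₁ = (HALF-PM⁺)_L + (HALF-PM⁺)_H + A` vanishes at every weight vector supported on `m` — the coefficients
  supported inside `m` are `0` (`coef_eq_of_face` on the maximal degenerate face containing `m`, `coverZ`), the
  Bernstein basis functions of the other profiles vanish on the face;
* `beta1_K5_pos_iff`: `β₁ > 0` at every weight vector interior on `m` ⟺ `m` is not degenerate;
* `beta1_K5_zero_iff`: `β₁ = 0` at every admissible weight vector supported on `m` ⟺ `m` is degenerate
  (the centre `½·1_m` of the face separates the two cases).
So the equality locus of the weighted (PM) on five-vertex bases is EXACTLY the set of degenerate placements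
(`RuleB`: the root pair separates `o` from `b`; a root reaches neither `o` nor `u` avoiding the other root;
`o` reaches neither root).  Standard axioms.
-/

namespace Summit.Ventures.PercRepro2

open Hub

namespace K5

namespace PM

/-! ## The zero side, and the two «iff»s -/

section Face

variable {R : Type*} [Field R] [LinearOrder R] [IsStrictOrderedRing R]

omit [LinearOrder R] [IsStrictOrderedRing R] in
/-- **THE EQUALITY LOCUS OF THE WEIGHTED (PM) ON FIVE-VERTEX BASES — THE ZERO SIDE.**  On every degenerate edge
set `m` (`RuleB m = true`) the cleared typed bracket `β₁` vanishes at every weight vector supported on `m`. -/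
theorem beta1_K5_zero_of_face (m : ℕ) (hm : m < 1024) (hr : RuleB m = true) (p : Fin 10 → R)
    (hp₀ : ∀ e : Fin 10, m.testBit e = false → p e = 0) :
    
    prob p (connEvent ends5 1 2)ᶜ *
          (prob p (connEvent ends5 1 2)ᶜ * prob p (connEvent ends5 1 4 ∩ connEvent ends5 2 3 ∩ (connEvent ends5 1 0 ∪ connEvent ends5 2 0) ∩ (connEvent ends5 1 2)ᶜ) -
            prob p (connEvent ends5 1 4 ∩ (connEvent ends5 1 2)ᶜ) * prob p (connEvent ends5 2 3 ∩ (connEvent ends5 1 0 ∪ connEvent ends5 2 0) ∩ (connEvent ends5 1 2)ᶜ)) -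
        prob p ((connEvent ends5 1 0 ∪ connEvent ends5 2 0) ∩ (connEvent ends5 1 2)ᶜ) *
          (prob p (connEvent ends5 1 2)ᶜ * prob p (connEvent ends5 1 4 ∩ connEvent ends5 2 3 ∩ (connEvent ends5 1 2)ᶜ) -
            prob p (connEvent ends5 1 4 ∩ (connEvent ends5 1 2)ᶜ) * prob p (connEvent ends5 2 3 ∩ (connEvent ends5 1 2)ᶜ)) -
        prob p (connEvent ends5 1 2)ᶜ *
          (prob p (connEvent ends5 1 2)ᶜ * prob p (connEvent ends5 1 4 ∩ connEvent ends5 2 0 ∩ (connEvent ends5 1 2)ᶜ) -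
            prob p (connEvent ends5 1 4 ∩ (connEvent ends5 1 2)ᶜ) * prob p (connEvent ends5 2 0 ∩ (connEvent ends5 1 2)ᶜ)) +
        prob p (connEvent ends5 1 2)ᶜ *
          (prob p (connEvent ends5 1 2)ᶜ * prob p (connEvent ends5 2 4 ∩ connEvent ends5 1 3 ∩ (connEvent ends5 1 0 ∪ connEvent ends5 2 0) ∩ (connEvent ends5 1 2)ᶜ) -
            prob p (connEvent ends5 2 4 ∩ (connEvent ends5 1 2)ᶜ) * prob p (connEvent ends5 1 3 ∩ (connEvent ends5 1 0 ∪ connEvent ends5 2 0) ∩ (connEvent ends5 1 2)ᶜ)) -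
        prob p ((connEvent ends5 1 0 ∪ connEvent ends5 2 0) ∩ (connEvent ends5 1 2)ᶜ) *
          (prob p (connEvent ends5 1 2)ᶜ * prob p (connEvent ends5 2 4 ∩ connEvent ends5 1 3 ∩ (connEvent ends5 1 2)ᶜ) -
            prob p (connEvent ends5 2 4 ∩ (connEvent ends5 1 2)ᶜ) * prob p (connEvent ends5 1 3 ∩ (connEvent ends5 1 2)ᶜ)) -
        prob p (connEvent ends5 1 2)ᶜ *
          (prob p (connEvent ends5 1 2)ᶜ * prob p (connEvent ends5 2 4 ∩ connEvent ends5 1 0 ∩ (connEvent ends5 1 2)ᶜ) -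
            prob p (connEvent ends5 2 4 ∩ (connEvent ends5 1 2)ᶜ) * prob p (connEvent ends5 1 0 ∩ (connEvent ends5 1 2)ᶜ)) +
        (prob p ((connEvent ends5 1 3 ∪ connEvent ends5 2 3) ∩ (connEvent ends5 1 2)ᶜ) - prob p (connEvent ends5 1 2)ᶜ) *
          (prob p (connEvent ends5 1 2)ᶜ * prob p (connEvent ends5 1 4 ∩ connEvent ends5 2 0 ∩ (connEvent ends5 1 2)ᶜ) - prob p (connEvent ends5 1 4 ∩ (connEvent ends5 1 2)ᶜ) * prob p (connEvent ends5 2 0 ∩ (connEvent ends5 1 2)ᶜ) +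
            prob p (connEvent ends5 1 2)ᶜ * prob p (connEvent ends5 2 4 ∩ connEvent ends5 1 0 ∩ (connEvent ends5 1 2)ᶜ) - prob p (connEvent ends5 2 4 ∩ (connEvent ends5 1 2)ᶜ) * prob p (connEvent ends5 1 0 ∩ (connEvent ends5 1 2)ᶜ)) = 0 := by
  rw [beta1_eq_bern]
  refine Finset.sum_eq_zero fun k _ => ?_
  by_cases hk : ∀ e : Fin 10, k e ≠ 0 → m.testBit e = true
  · obtain ⟨i, hi⟩ := coverZ ⟨m, hm⟩ hr
    have hc := coef_eq_of_face (Mx i) (faceZero_all i) k fun e he => hi e (hk e he)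
    rw [hc, sub_self, mul_zero]
  · obtain ⟨e, he⟩ := not_forall.1 hk
    obtain ⟨hke, hme⟩ := Classical.not_imp.1 he
    have hpe : p e = 0 := hp₀ e (by simpa using hme)
    have hb : bern p k = 0 := by
      unfold bern
      apply Finset.prod_eq_zero (Finset.mem_univ e)
      rw [hpe, zero_pow (fun h => hke (Fin.ext (by simpa using h)))]
      simp
    rw [hb, zero_mul]

/-- The centre of the face `m`: weight `1/2` on the edges of `m`, `0` off `m`. -/
def centre (m : ℕ) : Fin 10 → R := fun e => if m.testBit e = true then (1 / 2 : R) else 0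

omit [LinearOrder R] [IsStrictOrderedRing R] in
/-- The centre vanishes off `m`. -/
lemma centre_off {m : ℕ} {e : Fin 10} (he : m.testBit e = false) : centre (R := R) m e = 0 := by
  unfold centre
  rw [he]
  exact if_neg Bool.false_ne_true

omit [LinearOrder R] [IsStrictOrderedRing R] in
/-- The centre is `1/2` on `m`. -/
lemma centre_on {m : ℕ} {e : Fin 10} (he : m.testBit e = true) : centre (R := R) m e = 1 / 2 := by
  unfold centre
  rw [he]
  exact if_pos rfl

/-- The centre is interior on `m`. -/
lemma centre_on_pos {m : ℕ} {e : Fin 10} (he : m.testBit e = true) :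
    0 < centre (R := R) m e ∧ centre (R := R) m e < 1 := by
  rw [centre_on he]
  exact ⟨one_half_pos, one_half_lt_one⟩

/-- The centre is an admissible weight vector. -/
lemma centre_01 (m : ℕ) (e : Fin 10) : 0 ≤ centre (R := R) m e ∧ centre (R := R) m e ≤ 1 := by
  rcases Bool.eq_false_or_eq_true (m.testBit e) with h | h
  · rw [centre_on h]; exact ⟨one_half_pos.le, one_half_lt_one.le⟩
  · rw [centre_off h]; exact ⟨le_rfl, zero_le_one⟩

/-- **THE EQUALITY LOCUS, FIRST «IFF»**: `β₁ > 0` at every weight vector interior on `m` ⟺ `m` is not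
degenerate. -/
theorem beta1_K5_pos_iff (m : ℕ) (hm : m < 1024) :
    (∀ p : Fin 10 → R, (∀ e : Fin 10, m.testBit e = true → 0 < p e ∧ p e < 1) →
      (∀ e : Fin 10, m.testBit e = false → p e = 0) →
      0 < 
    prob p (connEvent ends5 1 2)ᶜ *
          (prob p (connEvent ends5 1 2)ᶜ * prob p (connEvent ends5 1 4 ∩ connEvent ends5 2 3 ∩ (connEvent ends5 1 0 ∪ connEvent ends5 2 0) ∩ (connEvent ends5 1 2)ᶜ) -
            prob p (connEvent ends5 1 4 ∩ (connEvent ends5 1 2)ᶜ) * prob p (connEvent ends5 2 3 ∩ (connEvent ends5 1 0 ∪ connEvent ends5 2 0) ∩ (connEvent ends5 1 2)ᶜ)) -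
        prob p ((connEvent ends5 1 0 ∪ connEvent ends5 2 0) ∩ (connEvent ends5 1 2)ᶜ) *
          (prob p (connEvent ends5 1 2)ᶜ * prob p (connEvent ends5 1 4 ∩ connEvent ends5 2 3 ∩ (connEvent ends5 1 2)ᶜ) -
            prob p (connEvent ends5 1 4 ∩ (connEvent ends5 1 2)ᶜ) * prob p (connEvent ends5 2 3 ∩ (connEvent ends5 1 2)ᶜ)) -
        prob p (connEvent ends5 1 2)ᶜ *
          (prob p (connEvent ends5 1 2)ᶜ * prob p (connEvent ends5 1 4 ∩ connEvent ends5 2 0 ∩ (connEvent ends5 1 2)ᶜ) -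
            prob p (connEvent ends5 1 4 ∩ (connEvent ends5 1 2)ᶜ) * prob p (connEvent ends5 2 0 ∩ (connEvent ends5 1 2)ᶜ)) +
        prob p (connEvent ends5 1 2)ᶜ *
          (prob p (connEvent ends5 1 2)ᶜ * prob p (connEvent ends5 2 4 ∩ connEvent ends5 1 3 ∩ (connEvent ends5 1 0 ∪ connEvent ends5 2 0) ∩ (connEvent ends5 1 2)ᶜ) -
            prob p (connEvent ends5 2 4 ∩ (connEvent ends5 1 2)ᶜ) * prob p (connEvent ends5 1 3 ∩ (connEvent ends5 1 0 ∪ connEvent ends5 2 0) ∩ (connEvent ends5 1 2)ᶜ)) -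
        prob p ((connEvent ends5 1 0 ∪ connEvent ends5 2 0) ∩ (connEvent ends5 1 2)ᶜ) *
          (prob p (connEvent ends5 1 2)ᶜ * prob p (connEvent ends5 2 4 ∩ connEvent ends5 1 3 ∩ (connEvent ends5 1 2)ᶜ) -
            prob p (connEvent ends5 2 4 ∩ (connEvent ends5 1 2)ᶜ) * prob p (connEvent ends5 1 3 ∩ (connEvent ends5 1 2)ᶜ)) -
        prob p (connEvent ends5 1 2)ᶜ *
          (prob p (connEvent ends5 1 2)ᶜ * prob p (connEvent ends5 2 4 ∩ connEvent ends5 1 0 ∩ (connEvent ends5 1 2)ᶜ) -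
            prob p (connEvent ends5 2 4 ∩ (connEvent ends5 1 2)ᶜ) * prob p (connEvent ends5 1 0 ∩ (connEvent ends5 1 2)ᶜ)) +
        (prob p ((connEvent ends5 1 3 ∪ connEvent ends5 2 3) ∩ (connEvent ends5 1 2)ᶜ) - prob p (connEvent ends5 1 2)ᶜ) *
          (prob p (connEvent ends5 1 2)ᶜ * prob p (connEvent ends5 1 4 ∩ connEvent ends5 2 0 ∩ (connEvent ends5 1 2)ᶜ) - prob p (connEvent ends5 1 4 ∩ (connEvent ends5 1 2)ᶜ) * prob p (connEvent ends5 2 0 ∩ (connEvent ends5 1 2)ᶜ) +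
            prob p (connEvent ends5 1 2)ᶜ * prob p (connEvent ends5 2 4 ∩ connEvent ends5 1 0 ∩ (connEvent ends5 1 2)ᶜ) - prob p (connEvent ends5 2 4 ∩ (connEvent ends5 1 2)ᶜ) * prob p (connEvent ends5 1 0 ∩ (connEvent ends5 1 2)ᶜ))) ↔ RuleB m = false := by
  constructor
  · intro h
    rcases Bool.eq_false_or_eq_true (RuleB m) with hr | hr
    · exfalso
      have hpos := h (centre (R := R) m) (fun e he => centre_on_pos he)
        (fun e he => centre_off he)
      have hzero := beta1_K5_zero_of_face m hm hr (centre (R := R) m)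
        (fun e he => centre_off he)
      rw [hzero] at hpos
      exact lt_irrefl _ hpos
    · exact hr
  · intro hr p hp₁ hp₀
    exact beta1_K5_pos_of_face m hm hr p hp₁ hp₀

/-- **THE EQUALITY LOCUS, SECOND «IFF»**: `β₁ ≡ 0` on the face of `m` (at every admissible weight vector
supported on `m`) ⟺ `m` is degenerate. -/
theorem beta1_K5_zero_iff (m : ℕ) (hm : m < 1024) :
    (∀ p : Fin 10 → R, (∀ e : Fin 10, 0 ≤ p e ∧ p e ≤ 1) →
      (∀ e : Fin 10, m.testBit e = false → p e = 0) →
      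
    prob p (connEvent ends5 1 2)ᶜ *
          (prob p (connEvent ends5 1 2)ᶜ * prob p (connEvent ends5 1 4 ∩ connEvent ends5 2 3 ∩ (connEvent ends5 1 0 ∪ connEvent ends5 2 0) ∩ (connEvent ends5 1 2)ᶜ) -
            prob p (connEvent ends5 1 4 ∩ (connEvent ends5 1 2)ᶜ) * prob p (connEvent ends5 2 3 ∩ (connEvent ends5 1 0 ∪ connEvent ends5 2 0) ∩ (connEvent ends5 1 2)ᶜ)) -
        prob p ((connEvent ends5 1 0 ∪ connEvent ends5 2 0) ∩ (connEvent ends5 1 2)ᶜ) *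
          (prob p (connEvent ends5 1 2)ᶜ * prob p (connEvent ends5 1 4 ∩ connEvent ends5 2 3 ∩ (connEvent ends5 1 2)ᶜ) -
            prob p (connEvent ends5 1 4 ∩ (connEvent ends5 1 2)ᶜ) * prob p (connEvent ends5 2 3 ∩ (connEvent ends5 1 2)ᶜ)) -
        prob p (connEvent ends5 1 2)ᶜ *
          (prob p (connEvent ends5 1 2)ᶜ * prob p (connEvent ends5 1 4 ∩ connEvent ends5 2 0 ∩ (connEvent ends5 1 2)ᶜ) -
            prob p (connEvent ends5 1 4 ∩ (connEvent ends5 1 2)ᶜ) * prob p (connEvent ends5 2 0 ∩ (connEvent ends5 1 2)ᶜ)) +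
        prob p (connEvent ends5 1 2)ᶜ *
          (prob p (connEvent ends5 1 2)ᶜ * prob p (connEvent ends5 2 4 ∩ connEvent ends5 1 3 ∩ (connEvent ends5 1 0 ∪ connEvent ends5 2 0) ∩ (connEvent ends5 1 2)ᶜ) -
            prob p (connEvent ends5 2 4 ∩ (connEvent ends5 1 2)ᶜ) * prob p (connEvent ends5 1 3 ∩ (connEvent ends5 1 0 ∪ connEvent ends5 2 0) ∩ (connEvent ends5 1 2)ᶜ)) -
        prob p ((connEvent ends5 1 0 ∪ connEvent ends5 2 0) ∩ (connEvent ends5 1 2)ᶜ) *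
          (prob p (connEvent ends5 1 2)ᶜ * prob p (connEvent ends5 2 4 ∩ connEvent ends5 1 3 ∩ (connEvent ends5 1 2)ᶜ) -
            prob p (connEvent ends5 2 4 ∩ (connEvent ends5 1 2)ᶜ) * prob p (connEvent ends5 1 3 ∩ (connEvent ends5 1 2)ᶜ)) -
        prob p (connEvent ends5 1 2)ᶜ *
          (prob p (connEvent ends5 1 2)ᶜ * prob p (connEvent ends5 2 4 ∩ connEvent ends5 1 0 ∩ (connEvent ends5 1 2)ᶜ) -
            prob p (connEvent ends5 2 4 ∩ (connEvent ends5 1 2)ᶜ) * prob p (connEvent ends5 1 0 ∩ (connEvent ends5 1 2)ᶜ)) +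
        (prob p ((connEvent ends5 1 3 ∪ connEvent ends5 2 3) ∩ (connEvent ends5 1 2)ᶜ) - prob p (connEvent ends5 1 2)ᶜ) *
          (prob p (connEvent ends5 1 2)ᶜ * prob p (connEvent ends5 1 4 ∩ connEvent ends5 2 0 ∩ (connEvent ends5 1 2)ᶜ) - prob p (connEvent ends5 1 4 ∩ (connEvent ends5 1 2)ᶜ) * prob p (connEvent ends5 2 0 ∩ (connEvent ends5 1 2)ᶜ) +
            prob p (connEvent ends5 1 2)ᶜ * prob p (connEvent ends5 2 4 ∩ connEvent ends5 1 0 ∩ (connEvent ends5 1 2)ᶜ) - prob p (connEvent ends5 2 4 ∩ (connEvent ends5 1 2)ᶜ) * prob p (connEvent ends5 1 0 ∩ (connEvent ends5 1 2)ᶜ)) = 0) ↔ RuleB m = true := by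
  constructor
  · intro h
    rcases Bool.eq_false_or_eq_true (RuleB m) with hr | hr
    · exact hr
    · exfalso
      have hpos := beta1_K5_pos_of_face m hm hr (centre (R := R) m)
        (fun e he => centre_on_pos he)
        (fun e he => centre_off he)
      have hzero := h (centre (R := R) m)
        (centre_01 m)
        (fun e he => centre_off he)
      rw [hzero] at hpos
      exact lt_irrefl _ hpos
  · intro hr p _ hp₀
    exact beta1_K5_zero_of_face m hm hr p hp₀

end Face

end PM

end K5

end Summit.Ventures.PercRepro2
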